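import Summits.AtomisticToContinuum.Crystallization.Theorems.FrustratedLawDichotomyStrainedPatchHomExteriorRayKit
import Summits.AtomisticToContinuum.Crystallization.Theorems.FrustratedLawDichotomyStrainedPatchHomEntryLeafHTA2

/-!
# Strained patch, `(H)` hcp exterior certificate (architecture R3) — E3: THE EXTERIOR SLAB LEAF `exteriorOK` (v1, positive floors) AND ITS SOUNDNESS, a kernel Bool
# verdict whose accepted boxes are semantic facts at EVERY level (decomp-a2c hand 2, generation 39; structural #13)

Critic rows 1470 (A5) / 1472 (A) («hand-2: type E3 … `exteriorOK`/`exteriorOK_sound`»); hand-1 g40 COORD («E3 Bool side stays yours»).  This is the Bool verdict for ONE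
complement slab `(c, w)` of a column, v1 = the NESTED positive-floor exterior (E2′ / XE / XS); the signed-floor annulus (β) takes the same fields plus dwell data
(`…HomExteriorRaySigned`, next file).  DESIGN (no new analysis; every field feeds a landed theorem):

* the slab box `(c, w)` is the leaf's own box; all column boxes share its entry (`U`) part (`sameU`, checked);
* the HULL box `(cH, wH)` ⊇ cell ∪ slab (ξ-parts) carries the LABEL CLASSIFICATION of the existing HT kit: `B := htBU cH wH`, `R := htRU cH wH`, `htK cH wH < SC`,
  `htROKU cH wH`, `xiBallOK cH wH` — so `hBin/hR` of `hver_of_slabParts_pieces` hold at every `ξ` of the slab (`norm_le_seven_of_htIn`, `seven_lt_norm_of_not_mem_htUniv`,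
  `six_le_norm_of_lo`, verbatim the cell proof's block at the hull box) and `‖ξ‖, ‖ξ₀‖ ≤ 1/4`;
* the CELL box `(cC, wC)` with the cell's tilt `J` carries the reference `ξ₀ := affShuf J cC U` (`jacOK J wC` ⇒ `ξ₀` in the cell ξ-box) and the slope bound over `B`:
  `htNaiOKA2 cC wC J B` ⇒ `refForce_chunkA2_le` with `f₀ = htGsA2 cC wC J B / SC`;
* the CHAIN `ch : List (box × box × D × lam)`: per box `curvCheckLJM` with the label split `B.filter (ljLabelOK …)` (so `(Lc ++ Ln).toFinset = B.toFinset`), the Gershgorin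
  floor `gersh3 D lam lmin` (`(lmin/SC)‖v‖² ≤ M(v)` for every direction — (s4) anisotropy enters only through the choice of `D`; direction cones are a v2 refinement),
  and the integer containments cell ⊆ box 0 ⊆ … ⊆ box (m−1) ⊇ slab, cell ∪ slab ⊆ hull;
* the GAP `g > 0` between cell and slab on coordinate `i` ⇒ `hΔ` and `ρ = (3/4)(g/SC)` (`…HomExteriorRayKit`), and the DOMINATION in integers:
  `4·SC²·8892·279936 + 4·SC·Gs·Z + 4·SC²·|R|·823543 < 3·lmin·g·Z`, `Z = 7⁷·6⁷ = 230539333248` (i.e. `S₇♯ + Gs/SC + |R|·6⁻⁷ < (lmin/SC)·ρ`, `S₇♯ = 8892/7⁷`).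

§1 the small Bool combinators + their unpacking; §2 `gersh3_sound`; §3 ★★★ `exteriorOK` and `exteriorOK_sound` (the FULL `hver` shape, any `μ`) via
`hver_exterior_of_curvChecks_uniformFloor` (p854094).  The one-line semantic packaging `semOKH_of_exteriorOK` (over `semOKH_of_sound`) lives in the follow-up module
`…HomExteriorLeafSem` so that this verdict file stays free of the semantic import chain.  0 sorry; standard axioms; computable defs only.
`--supports stmt-AtomisticToContinuum-27623`.
-/

noncomputable section

open Set

namespace Summit.AtomisticToContinuum.Crystallization.Theorems.FrustratedLawDichotomyStrainedPatchHomExteriorRay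

open scoped BigOperators RealInnerProductSpace
open Literature.Analysis.ValidatedNumerics.Numerics
open Summit.AtomisticToContinuum.Crystallization.Theorems.ChargedEnergyGapNegative (E3)
open Summit.AtomisticToContinuum.Crystallization.Theorems.FrustratedLawDichotomySchurCut (effPot w₄₅ ω₄)
open Summit.AtomisticToContinuum.Crystallization.Theorems.FrustratedLawDichotomyAveragingRuleTightFree (TightNearCap BadNearCap)
open Summit.AtomisticToContinuum.Crystallization.Theorems.FrustratedLawDichotomyExemptAbsorption (ExemptNear)
open Summit.AtomisticToContinuum.Crystallization.Theorems.FrustratedLawDichotomyStrainedPatchHomSplit (ExRec latPt hexFrame hcpShift)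
open Summit.AtomisticToContinuum.Crystallization.Theorems.FrustratedLawDichotomyStrainedPatchTaylorChord (segGd)
open Summit.AtomisticToContinuum.Crystallization.Theorems.FrustratedLawDichotomyStrainedPatchHomCurvLeaf (nodup_filter_append toFinset_filter_append)
open Summit.AtomisticToContinuum.Crystallization.Theorems.FrustratedLawDichotomyStrainedPatchHomCurvLJ (curvCheckLJM ljLabelOK)
open Summit.AtomisticToContinuum.Crystallization.Theorems.FrustratedLawDichotomyStrainedPatchHomForceJacN (fjQ boxLabels11 boxLabels11_toFinset)
open Summit.AtomisticToContinuum.Crystallization.Theorems.FrustratedLawDichotomyStrainedPatchHomForceHcp (xiBallOK norm_le_quarter_of_xiBallOK)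
open Summit.AtomisticToContinuum.Crystallization.Theorems.FrustratedLawDichotomyStrainedPatchHomSlopeLJAffine (affShuf abs_affShuf_sub_le jw)
open Summit.AtomisticToContinuum.Crystallization.Theorems.FrustratedLawDichotomyStrainedPatchHomEntryLeafHT (htBU htRU htUniv htIn htK htROKU htBU_nodup
  htNaiOKA2 htGsA2 refForce_chunkA2_le jacOK jacOK_spec norm_le_seven_of_htIn lo_le_of_norm_le_seven six_le_norm_of_lo seven_lt_norm_of_not_mem_htUniv
  mem_boxLabels11_of_mem_htUniv mem_htUniv_of_mem_htBU htIn_of_mem_htBU mem_htBU_of_htIn)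

/-- Abbreviation for the kit's box type (twelve scaled-integer coordinates). -/
abbrev Bx := (Fin 3 × Fin 3) ⊕ Fin 3 → ℤ

/-! ## §1 Small Bool combinators -/

/-- The entry (`U`) parts of two boxes coincide. -/
def sameU (c w c' w' : Bx) : Bool := decide (∀ ab : Fin 3 × Fin 3, c' (Sum.inl ab) = c (Sum.inl ab) ∧ w' (Sum.inl ab) = w (Sum.inl ab))

/-- `sameU` transports the entry-box hypothesis. [formal bookkeeping] -/
theorem hbox_of_sameU {c w c' w' : Bx} (h : sameU c w c' w' = true) {U : E3 →L[ℝ] E3}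
    (hbox : ∀ ab : Fin 3 × Fin 3, |(U (EuclideanSpace.single ab.2 (1 : ℝ))) ab.1 - (c (Sum.inl ab) : ℝ) / SC| ≤ (w (Sum.inl ab) : ℝ) / SC) :
    ∀ ab : Fin 3 × Fin 3, |(U (EuclideanSpace.single ab.2 (1 : ℝ))) ab.1 - (c' (Sum.inl ab) : ℝ) / SC| ≤ (w' (Sum.inl ab) : ℝ) / SC := by
  simp only [sameU, decide_eq_true_eq] at h
  intro ab; rw [(h ab).1, (h ab).2]; exact hbox ab

/-- The ξ-part of `(c, w)` is contained in the ξ-part of `(c', w')` (integer endpoints). -/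
def xiSub (c w c' w' : Bx) : Bool :=
  decide (∀ i : Fin 3, c' (Sum.inr i) - w' (Sum.inr i) ≤ c (Sum.inr i) - w (Sum.inr i) ∧ c (Sum.inr i) + w (Sum.inr i) ≤ c' (Sum.inr i) + w' (Sum.inr i))

/-- `xiSub` transports the shuffle-box hypothesis. [arithmetic] -/
theorem hxi_of_xiSub {c w c' w' : Bx} (h : xiSub c w c' w' = true) {ξ : E3} (hξ : ∀ i : Fin 3, |ξ i - (c (Sum.inr i) : ℝ) / SC| ≤ (w (Sum.inr i) : ℝ) / SC) :
    ∀ i : Fin 3, |ξ i - (c' (Sum.inr i) : ℝ) / SC| ≤ (w' (Sum.inr i) : ℝ) / SC := by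
  simp only [xiSub, decide_eq_true_eq] at h
  exact (mem_xiBox).1 (xiBox_mono (c := c) (w := w) (c' := c') (w' := w') (fun i => h i) ((mem_xiBox).2 hξ))

/-- The chain entries (centre, half-width, anisotropy matrix, floor) with a harmless default beyond the list. -/
def chC (ch : List (Bx × Bx × (Fin 3 → Fin 3 → ℤ) × ℤ)) (k : ℕ) : Bx := (ch.getD k (fun _ => 0, fun _ => 0, fun _ _ => 0, 0)).1
/-- see `chC`. -/
def chW (ch : List (Bx × Bx × (Fin 3 → Fin 3 → ℤ) × ℤ)) (k : ℕ) : Bx := (ch.getD k (fun _ => 0, fun _ => 0, fun _ _ => 0, 0)).2.1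
/-- see `chC`. -/
def chD (ch : List (Bx × Bx × (Fin 3 → Fin 3 → ℤ) × ℤ)) (k : ℕ) : Fin 3 → Fin 3 → ℤ := (ch.getD k (fun _ => 0, fun _ => 0, fun _ _ => 0, 0)).2.2.1
/-- see `chC`. -/
def chL (ch : List (Bx × Bx × (Fin 3 → Fin 3 → ℤ) × ℤ)) (k : ℕ) : ℤ := (ch.getD k (fun _ => 0, fun _ => 0, fun _ _ => 0, 0)).2.2.2

/-! ## §2 The Gershgorin direction floor -/

/-- **Gershgorin floor (3 × 3, integers)**: `2(lmin − lam) ≤ 2 D_ii − Σ_{j ≠ i} (|D_ij| + |D_ji|)` for `i = 0, 1, 2`. -/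
def gersh3 (D : Fin 3 → Fin 3 → ℤ) (lam lmin : ℤ) : Bool :=
  decide (2 * (lmin - lam) ≤ 2 * D 0 0 - (|D 0 1| + |D 1 0| + |D 0 2| + |D 2 0|)) &&
  decide (2 * (lmin - lam) ≤ 2 * D 1 1 - (|D 1 0| + |D 0 1| + |D 1 2| + |D 2 1|)) &&
  decide (2 * (lmin - lam) ≤ 2 * D 2 2 - (|D 2 0| + |D 0 2| + |D 2 1| + |D 1 2|))

/-- `d·(x·y) ≥ −|d|(x² + y²)/2`. [arithmetic] -/
theorem mul_mul_ge_neg_half (d x y : ℝ) : -(|d| * (x ^ 2 + y ^ 2) / 2) ≤ d * (x * y) := by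
  have h1 : |x * y| ≤ (x ^ 2 + y ^ 2) / 2 := by
    rw [abs_le]; constructor <;> nlinarith [sq_nonneg (x - y), sq_nonneg (x + y)]
  have h2 : |d * (x * y)| ≤ |d| * ((x ^ 2 + y ^ 2) / 2) := by rw [abs_mul]; exact mul_le_mul_of_nonneg_left h1 (abs_nonneg d)
  have h3 := neg_abs_le (d * (x * y))
  linarith

/-- ★ **GERSHGORIN SOUNDNESS**: `gersh3 D lam lmin` ⟹ `(lmin/SC)‖v‖² ≤ (lam/SC)‖v‖² + Σ_ij (D_ij/SC) v_i v_j` for EVERY `v`. [folklore] -/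
theorem gersh3_sound {D : Fin 3 → Fin 3 → ℤ} {lam lmin : ℤ} (h : gersh3 D lam lmin = true) (v : E3) :
    (lmin : ℝ) / SC * ‖v‖ ^ 2 ≤ (lam : ℝ) / SC * ‖v‖ ^ 2 + ∑ i : Fin 3, ∑ j : Fin 3, (D i j : ℝ) / SC * (v i * v j) := by
  have hS : (0 : ℝ) < SC := SC_pos
  simp only [gersh3, Bool.and_eq_true, decide_eq_true_eq] at h
  obtain ⟨⟨g0, g1⟩, g2⟩ := h
  have g0' : (2 : ℝ) * (lmin - lam) ≤ 2 * D 0 0 - (|(D 0 1 : ℝ)| + |(D 1 0 : ℝ)| + |(D 0 2 : ℝ)| + |(D 2 0 : ℝ)|) := by exact_mod_cast g0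
  have g1' : (2 : ℝ) * (lmin - lam) ≤ 2 * D 1 1 - (|(D 1 0 : ℝ)| + |(D 0 1 : ℝ)| + |(D 1 2 : ℝ)| + |(D 2 1 : ℝ)|) := by exact_mod_cast g1
  have g2' : (2 : ℝ) * (lmin - lam) ≤ 2 * D 2 2 - (|(D 2 0 : ℝ)| + |(D 0 2 : ℝ)| + |(D 2 1 : ℝ)| + |(D 1 2 : ℝ)|) := by exact_mod_cast g2
  have hn : ‖v‖ ^ 2 = v 0 ^ 2 + v 1 ^ 2 + v 2 ^ 2 := by
    rw [EuclideanSpace.norm_eq, Real.sq_sqrt (Finset.sum_nonneg fun i _ => sq_nonneg _), Fin.sum_univ_three]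
    simp [Real.norm_eq_abs, sq_abs]
  simp only [Fin.sum_univ_three]
  rw [hn]
  have e01 := mul_mul_ge_neg_half (D 0 1 : ℝ) (v 0) (v 1)
  have e10 := mul_mul_ge_neg_half (D 1 0 : ℝ) (v 1) (v 0)
  have e02 := mul_mul_ge_neg_half (D 0 2 : ℝ) (v 0) (v 2)
  have e20 := mul_mul_ge_neg_half (D 2 0 : ℝ) (v 2) (v 0)
  have e12 := mul_mul_ge_neg_half (D 1 2 : ℝ) (v 1) (v 2)
  have e21 := mul_mul_ge_neg_half (D 2 1 : ℝ) (v 2) (v 1)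
  have s0 := sq_nonneg (v 0); have s1 := sq_nonneg (v 1); have s2 := sq_nonneg (v 2)
  -- everything is divided by SC > 0: clear it
  rw [show ∀ a b : ℝ, a / SC * b = (a * b) / SC from fun a b => by ring] -- normalise the leading terms
  have key : (lmin : ℝ) * (v 0 ^ 2 + v 1 ^ 2 + v 2 ^ 2) ≤ (lam : ℝ) * (v 0 ^ 2 + v 1 ^ 2 + v 2 ^ 2) +
      ((D 0 0 : ℝ) * (v 0 * v 0) + (D 0 1 : ℝ) * (v 0 * v 1) + (D 0 2 : ℝ) * (v 0 * v 2) +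
       ((D 1 0 : ℝ) * (v 1 * v 0) + (D 1 1 : ℝ) * (v 1 * v 1) + (D 1 2 : ℝ) * (v 1 * v 2)) +
       ((D 2 0 : ℝ) * (v 2 * v 0) + (D 2 1 : ℝ) * (v 2 * v 1) + (D 2 2 : ℝ) * (v 2 * v 2))) := by
    nlinarith [g0', g1', g2', e01, e10, e02, e20, e12, e21, s0, s1, s2, abs_nonneg (D 0 1 : ℝ), abs_nonneg (D 1 0 : ℝ), abs_nonneg (D 0 2 : ℝ),
      abs_nonneg (D 2 0 : ℝ), abs_nonneg (D 1 2 : ℝ), abs_nonneg (D 2 1 : ℝ)]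
  have := div_le_div_of_nonneg_right key hS.le
  have e : ∀ a b : ℝ, (a * b) / SC = a / SC * b := fun a b => by ring
  simp only [add_div, e] at this
  simpa only [e] using this

/-! ## §3 ★★★ The exterior slab leaf and its soundness -/

/-- The per-box chain check: curvature certificate with the hull's label list split by `ljLabelOK`, plus the Gershgorin floor. -/
def extChainOK (B : List (Fin 3 → ℤ)) (ch : List (Bx × Bx × (Fin 3 → Fin 3 → ℤ) × ℤ)) (lmin : ℤ) : Bool :=
  (List.range ch.length).all fun k =>
    curvCheckLJM (chC ch k) (chW ch k) (B.filter fun b => ljLabelOK (chC ch k) (chW ch k) b) (B.filter fun b => !ljLabelOK (chC ch k) (chW ch k) b)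
      (chD ch k) (chL ch k) && gersh3 (chD ch k) (chL ch k) lmin

/-- The chain geometry: common entry part, cell ⊆ box 0, box k ⊆ box k+1, slab ⊆ last box. -/
def extGeomOK (cC wC : Bx) (ch : List (Bx × Bx × (Fin 3 → Fin 3 → ℤ) × ℤ)) (c w : Bx) : Bool :=
  (List.range ch.length).all (fun k => sameU c w (chC ch k) (chW ch k)) &&
  xiSub cC wC (chC ch 0) (chW ch 0) && xiSub c w (chC ch (ch.length - 1)) (chW ch (ch.length - 1)) &&
  (List.range ch.length).all fun k => decide (k + 1 < ch.length) → xiSub (chC ch k) (chW ch k) (chC ch (k + 1)) (chW ch (k + 1))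

/-- ★★★ **THE EXTERIOR SLAB LEAF (v1, positive floors).**  `J, cC, wC`: the cell's tilt and box; `cH, wH`: the hull box; `ch`: the box chain; `lmin`: the common floor;
`g, i`: the integer gap and its coordinate; `(c, w)`: the SLAB box = the leaf's own box. -/
def exteriorOK (J : Fin 3 → Fin 3 × Fin 3 → ℤ) (cC wC cH wH : Bx) (ch : List (Bx × Bx × (Fin 3 → Fin 3 → ℤ) × ℤ)) (lmin g : ℤ) (i : Fin 3)
    (c w : Bx) : Bool :=
  sameU c w cC wC && sameU c w cH wH && xiBallOK cH wH && jacOK J wC && decide (htK cH wH < (SC : ℤ)) && htROKU cH wH &&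
  htNaiOKA2 cC wC J (htBU cH wH) && decide (0 < ch.length) && extChainOK (htBU cH wH) ch lmin && extGeomOK cC wC ch c w &&
  xiSub cC wC cH wH && xiSub c w cH wH && decide (0 < g) && decide (0 ≤ lmin) &&
  decide (cC (Sum.inr i) + wC (Sum.inr i) + g ≤ c (Sum.inr i) - w (Sum.inr i) ∨ c (Sum.inr i) + w (Sum.inr i) + g ≤ cC (Sum.inr i) - wC (Sum.inr i)) &&
  decide (4 * (SC : ℤ) ^ 2 * 8892 * 279936 + 4 * (SC : ℤ) * htGsA2 cC wC J (htBU cH wH) * 230539333248 +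
      4 * (SC : ℤ) ^ 2 * ((htRU cH wH).length : ℤ) * 823543 < 3 * lmin * g * 230539333248)

/-- ★★★ **SOUNDNESS OF THE EXTERIOR SLAB LEAF in the full `hver` shape, at EVERY level `μ`.** [folklore chaining: the cell kit's label block at the hull box,
`refForce_chunkA2_le` at the cell box, `gersh3_sound`, `…HomExteriorRayKit`, `hver_exterior_of_curvChecks_uniformFloor`] -/
theorem exteriorOK_sound {μ : ℤ} {J : Fin 3 → Fin 3 × Fin 3 → ℤ} {cC wC cH wH : Bx} {ch : List (Bx × Bx × (Fin 3 → Fin 3 → ℤ) × ℤ)} {lmin g : ℤ} {i : Fin 3}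
    {c w : Bx} (h : exteriorOK J cC wC cH wH ch lmin g i c w = true) (U : E3 →L[ℝ] E3) (ξ : E3)
    (_hsa : ∀ v v' : E3, ⟪U v, v'⟫ = ⟪v, U v'⟫) (hU : ‖U - 1‖ ≤ 1 / 4)
    (hbox : ∀ ab : Fin 3 × Fin 3, |(U (EuclideanSpace.single ab.2 (1 : ℝ))) ab.1 - (c (Sum.inl ab) : ℝ) / SC| ≤ (w (Sum.inl ab) : ℝ) / SC)
    (hξ : ∀ i : Fin 3, |ξ i - (c (Sum.inr i) : ℝ) / SC| ≤ (w (Sum.inr i) : ℝ) / SC) (_h0 : 0 ≤ ξ 0) (_h2 : 0 ≤ ξ 2) :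
    (∀ (M : ℕ) (z : Fin M → E3) (cc : Fin M), Function.Injective z →
        Set.range z = {x : E3 | dist x (z cc) ≤ 133 / 10 ∧ ∃ a : Fin 3 → ℤ,
          x = z cc + latPt U hexFrame a ∨ x = z cc + latPt U hexFrame a + U (hcpShift + ξ)} →
        TightNearCap (9 / 5) (3 / 2) z cc ∨ ExemptNear (9 / 5) ExRec z cc ∨ BadNearCap (9 / 5) (3 / 2) z cc) ∨
      (μ : ℝ) / SC ≤ ∑ b ∈ (Fintype.piFinset fun _ : Fin 3 => Finset.Icc (-7 : ℤ) 7).filter (fun b => b ≠ 0), effPot w₄₅ ω₄ (3 / 400) ‖latPt U hexFrame b‖ +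
        ∑ b ∈ (Fintype.piFinset fun _ : Fin 3 => Finset.Icc (-7 : ℤ) 7), effPot w₄₅ ω₄ (3 / 400) ‖latPt U hexFrame b + U (hcpShift + ξ)‖ := by
  classical
  have hS : (0 : ℝ) < SC := SC_pos
  unfold exteriorOK at h
  simp only [Bool.and_eq_true, decide_eq_true_eq] at h
  obtain ⟨⟨⟨⟨⟨⟨⟨⟨⟨⟨⟨⟨⟨⟨⟨hUC, hUH⟩, hball⟩, hjac⟩, hKlt⟩, hROK⟩, hNai⟩, hlen⟩, hchain⟩, hgeom⟩, hCH⟩, hSH⟩, hg⟩, hlmin⟩, hgap⟩, hdomZ⟩ := h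
  -- entry boxes
  have hboxC := hbox_of_sameU hUC hbox
  have hboxH := hbox_of_sameU hUH hbox
  -- the reference: the cell's affine sheet point
  set ξ₀ : E3 := affShuf J cC U with hξ₀def
  have hξ₀C : ∀ m : Fin 3, |ξ₀ m - (cC (Sum.inr m) : ℝ) / SC| ≤ (wC (Sum.inr m) : ℝ) / SC := by
    intro m
    refine (abs_affShuf_sub_le (J := J) (w := wC) U hboxC m).trans ?_
    rw [div_le_div_iff_of_pos_right hS]
    exact_mod_cast jacOK_spec hjac m
  have hξ₀H := hxi_of_xiSub hCH hξ₀C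
  have hξH := hxi_of_xiSub hSH hξ
  have hn₀ : ‖ξ₀‖ ≤ 1 / 4 := norm_le_quarter_of_xiBallOK hball hξ₀H
  have hn : ‖ξ‖ ≤ 1 / 4 := norm_le_quarter_of_xiBallOK hball hξH
  -- label finsets from the HULL box (verbatim the cell proof's block at (cH, wH))
  set B : Finset (Fin 3 → ℤ) := (htBU cH wH).toFinset with hBdef
  set R : Finset (Fin 3 → ℤ) := (htRU cH wH).toFinset with hRdef
  have hB : B ⊆ Fintype.piFinset fun _ : Fin 3 => Finset.Icc (-11 : ℤ) 11 := by
    intro b hb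
    rw [← boxLabels11_toFinset]
    exact List.mem_toFinset.2 (mem_boxLabels11_of_mem_htUniv (mem_htUniv_of_mem_htBU (List.mem_toFinset.1 hb)))
  have hBin : ∀ bb ∈ B, ‖latPt U hexFrame bb + U (hcpShift + ξ)‖ ≤ 7 :=
    fun bb hbb => norm_le_seven_of_htIn U hboxH ξ hξH (htIn_of_mem_htBU (List.mem_toFinset.1 hbb))
  have hROK' : ∀ b ∈ htRU cH wH, 36 * (SC : ℤ) ≤ (fjQ cH wH b).lo := by
    intro b hb
    have := List.all_eq_true.1 hROK b hb
    simpa using this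
  have hR : ∀ bb ∈ (Fintype.piFinset fun _ : Fin 3 => Finset.Icc (-11 : ℤ) 11) \ B, ‖latPt U hexFrame bb + U (hcpShift + ξ)‖ ≤ 7 →
      bb ∈ R ∧ 6 ≤ ‖latPt U hexFrame bb + U (hcpShift + ξ)‖ := by
    intro bb hbb h7
    obtain ⟨hbox11, hnotB⟩ := Finset.mem_sdiff.1 hbb
    rw [← boxLabels11_toFinset] at hbox11
    have hbL : bb ∈ boxLabels11 := List.mem_toFinset.1 hbox11
    have hlo := lo_le_of_norm_le_seven U hboxH ξ hξH h7
    by_cases huniv : bb ∈ htUniv cH wH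
    swap
    · exact absurd h7 (not_le.2 (seven_lt_norm_of_not_mem_htUniv U hboxH hξH hKlt hbL huniv))
    by_cases hin : htIn cH wH bb = true
    · exact absurd (List.mem_toFinset.2 (mem_htBU_of_htIn huniv hin)) hnotB
    · have hmemR : bb ∈ htRU cH wH := by
        refine List.mem_filter.2 ⟨huniv, ?_⟩
        simp only [Bool.and_eq_true, Bool.not_eq_true', decide_eq_true_eq]
        exact ⟨by simpa using hin, hlo⟩
      exact ⟨List.mem_toFinset.2 hmemR, six_le_norm_of_lo U hboxH ξ hξH (hROK' bb hmemR)⟩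
  -- the slope bound at the reference over B (second-order centred chunk with L := htBU hull at the CELL box)
  have hf₀ := refForce_chunkA2_le (htBU_nodup cH wH) hNai U hU hboxC (by simpa [hξ₀def] using hn₀) ξ
  rw [← hBdef] at hf₀
  -- the chain
  set m : ℕ := ch.length with hmdef
  have hm : 0 < m := hlen
  simp only [extChainOK, List.all_eq_true, List.mem_range, Bool.and_eq_true] at hchain
  simp only [extGeomOK, List.all_eq_true, List.mem_range, Bool.and_eq_true, decide_eq_true_eq] at hgeom
  obtain ⟨⟨⟨hsameK, hC0⟩, hSlast⟩, hnestK⟩ := hgeom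
  have hLB : ∀ k, k < m → ((htBU cH wH).filter (fun b => ljLabelOK (chC ch k) (chW ch k) b) ++
      (htBU cH wH).filter (fun b => !ljLabelOK (chC ch k) (chW ch k) b)).toFinset = B :=
    fun k _ => by rw [hBdef]; exact toFinset_filter_append _ _
  have hnd : ∀ k, k < m → ((htBU cH wH).filter (fun b => ljLabelOK (chC ch k) (chW ch k) b) ++
      (htBU cH wH).filter (fun b => !ljLabelOK (chC ch k) (chW ch k) b)).Nodup :=
    fun k _ => nodup_filter_append (htBU_nodup cH wH) _
  have hchk : ∀ k, k < m → curvCheckLJM (chC ch k) (chW ch k) ((htBU cH wH).filter fun b => ljLabelOK (chC ch k) (chW ch k) b)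
      ((htBU cH wH).filter fun b => !ljLabelOK (chC ch k) (chW ch k) b) (chD ch k) (chL ch k) = true :=
    fun k hk => (hchain k hk).1
  have hUbox : ∀ k, k < m → ∀ ab : Fin 3 × Fin 3,
      |(U (EuclideanSpace.single ab.2 (1 : ℝ))) ab.1 - (chC ch k (Sum.inl ab) : ℝ) / SC| ≤ (chW ch k (Sum.inl ab) : ℝ) / SC :=
    fun k hk => hbox_of_sameU (hsameK k hk) hbox
  have hnest : ∀ k, k + 1 < m → ∀ j : Fin 3, chC ch (k + 1) (Sum.inr j) - chW ch (k + 1) (Sum.inr j) ≤ chC ch k (Sum.inr j) - chW ch k (Sum.inr j) ∧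
      chC ch k (Sum.inr j) + chW ch k (Sum.inr j) ≤ chC ch (k + 1) (Sum.inr j) + chW ch (k + 1) (Sum.inr j) := by
    intro k hk j
    have h' := hnestK k (by omega) hk
    simp only [xiSub, decide_eq_true_eq] at h'
    exact h' j
  have h0 := hxi_of_xiSub hC0 hξ₀C
  have h1 := hxi_of_xiSub hSlast hξ
  -- the gap: hΔ and the domination
  have hΔ : U (ξ - ξ₀) ≠ 0 := U_sub_ne_zero_of_gap hU i hg hξ hξ₀C hgap
  have hℓ : ∀ k, k < m → ((lmin : ℝ) / SC) * ‖U (ξ - ξ₀)‖ ^ 2 ≤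
      (chL ch k : ℝ) / SC * ‖U (ξ - ξ₀)‖ ^ 2 + ∑ i : Fin 3, ∑ j : Fin 3, (chD ch k i j : ℝ) / SC * ((U (ξ - ξ₀)) i * (U (ξ - ξ₀)) j) :=
    fun k hk => gersh3_sound (hchain k hk).2 _
  -- the domination inequality from the integers
  have hRcard : (R.card : ℝ) ≤ ((htRU cH wH).length : ℝ) := by
    rw [hRdef]; exact_mod_cast List.toFinset_card_le _
  have hS7 : (6000 / 343 * (7 : ℝ)⁻¹ ^ 4 + 2880 / 49 * (7 : ℝ)⁻¹ ^ 5 + 10 / 7 * (7 : ℝ)⁻¹ ^ 6 + 2 * (7 : ℝ)⁻¹ ^ 7) = 8892 / 823543 := by norm_num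
  have h67 : ((6 : ℝ)⁻¹ ^ 7) = 1 / 279936 := by norm_num
  have hZ : (4 * (SC : ℝ) ^ 2 * 8892 * 279936 + 4 * (SC : ℝ) * (htGsA2 cC wC J (htBU cH wH) : ℝ) * 230539333248 +
      4 * (SC : ℝ) ^ 2 * ((htRU cH wH).length : ℝ) * 823543) < 3 * (lmin : ℝ) * (g : ℝ) * 230539333248 := by exact_mod_cast hdomZ
  have hlmin0 : (0 : ℝ) ≤ (lmin : ℝ) / SC := div_nonneg (by exact_mod_cast hlmin) hS.le
  have hK : (6000 / 343 * (7 : ℝ)⁻¹ ^ 4 + 2880 / 49 * (7 : ℝ)⁻¹ ^ 5 + 10 / 7 * (7 : ℝ)⁻¹ ^ 6 + 2 * (7 : ℝ)⁻¹ ^ 7) +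
      (htGsA2 cC wC J (htBU cH wH) : ℝ) / SC + R.card * (6 : ℝ)⁻¹ ^ 7 < (lmin : ℝ) / SC * (3 / 4 * ((g : ℝ) / SC)) := by
    rw [hS7, h67]
    have hSC : (SC : ℝ) = 281474976710656 := by norm_num [SC]
    rw [hSC] at hZ ⊢
    have hR67 : (R.card : ℝ) * (1 / 279936) ≤ ((htRU cH wH).length : ℝ) * (1 / 279936) := mul_le_mul_of_nonneg_right hRcard (by norm_num)
    nlinarith [hZ, hR67]
  have hdom := dom_of_gap hU i hξ hξ₀C hgap hlmin0 hK
  -- assemble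
  exact hver_exterior_of_curvChecks_uniformFloor (μ := μ) hU hn₀ hn B R hB hBin hR hf₀ m hm (chC ch) (chW ch)
    (fun k => (htBU cH wH).filter fun b => ljLabelOK (chC ch k) (chW ch k) b) (fun k => (htBU cH wH).filter fun b => !ljLabelOK (chC ch k) (chW ch k) b)
    (chD ch) (chL ch) hLB hnd hchk hUbox hnest h0 h1 hΔ hℓ hdom

end Summit.AtomisticToContinuum.Crystallization.Theorems.FrustratedLawDichotomyStrainedPatchHomExteriorRay

end
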